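import Summits.Ventures.CertifiedQuantumChemistry.Statement
import Literature.MathematicalPhysics.QuantumLattice.HubbardNNNHoppingTorusSectorCertificate
import Literature.MathematicalPhysics.QuantumLattice.HubbardTorusLocalCertificate
import HarnessLib

/-!
# Ventures/CertifiedQuantumChemistry — Rows/SectorRows.lean: certificate predicates and their SOUNDNESS

HONEST FRAMING (verbatim): certified bounds for a stated model Hamiltonian in a stated basis; not a
claim about the real molecule beyond that model.

Typer T-04 (FANOUT row 18; lead ruling T-arch, `HOME/pub-qchem-lead/T03-DESIGN.md`). This file says
WHAT a certificate of the cell is, as a Lean predicate on the model `F : Model k` and the sector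
`(a, b)`, and PROVES that it implies the corresponding row predicate of `Statement.lean`:

* `LowerCertificate F a b lo` — "an exact SOS / v2RDM dual certificate with constant `lo` exists":
  an operator identity on the Fock space
  `H_F − c·1 = Σ_IJ Λ_IJ O_I† O_J                                   (Gram part, Λ ⪰ 0: the PSD blocks
                                                                     D, Q, G, T1, T2, T2′, γ, I−γ of
                                                                     FORMAT-qcl1 §4, stacked)
             + ( Σ_k (H_F X_k − X_k H_F)                            (commutator rows; may be empty)
               + Σ_i (Z_i (N̂_↑ − a) + (N̂_↑ − a) Z'_i)               (ideal of N̂_α − N_α, FORMAT-qcl1 §5)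
               + Σ_i (S_i (N̂_↓ − b) + (N̂_↓ − b) S'_i)               (ideal of N̂_β − N_β)
               + Σ_j b_j • w_j )                                    (CHARGED ladder words, dropped)
             + ( Σ_m d_m • (V_m† − V_m) + Σ_k a_k • v_k )            (rounding: anti-Hermitian parts,
                                                                     residual ladder words)
  with `(lo : ℝ) ≤ c − Σ_k ‖a_k‖`. Indexing is over `Fin n`'s so that the predicate is one `Prop`.
  SOUNDNESS `lowerRow_of_certificate`: for a symmetric model and `a, b ≤ k` it gives `LowerRow F a b lo`
  (evaluate the identity in the tracial ground state of `H_F` on the sector: the Gram part is `≥ 0`,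
  the ideal / commutator / charged / anti-Hermitian parts have zero (real) expectation, each residual
  word is a contraction costing at most `‖a_k‖`; tree theorem
  `Matrix.re_projState_ge_of_local_certificate`, the Hubbard analogue being
  `minEnergyOn_szSector_ge_of_sector_certificate`). This is v2RDM weak duality made rigorous:
  the D/Q/G/T1/T2′ matrices of any state are Gram matrices `⟨O_I† O_J⟩ ⪰ 0` (Mazziotti 2007 §II.B
  eqs. (8)–(13); Garrod–Percus 1964), the dual slack pairs with them non-negatively (Fukuda–Nakata–
  Yamashita 2007 §I), and the rounding residual is bounded by `Σ |p_i|·1` because every canonical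
  variable is the expectation of a contraction (FORMAT-qcl1 §7; Chaykin–Jansson–Keil et al. 2020).
* `UpperCertificate F a b hi` — "exact Rayleigh data of an explicit sector-pure trial state":
  `∃ ψ ≠ 0` supported on the `(a, b)` determinant sector with `Re ⟨ψ, H_F ψ⟩ ≤ hi · ⟨ψ, ψ⟩`
  (FORMAT-qcu0 §0: integer CI vector / interval-contracted MPS, `hi = E_U` a dyadic).
  SOUNDNESS `upperRow_of_certificate` (Rayleigh–Ritz in the sector, tree
  `sectorGroundEnergy_le_of_rayleigh`) and COMPLETENESS `upperCertificate_of_upperRow` (the sector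
  ground state is such a certificate), so `UpperCertificate ↔ UpperRow` for symmetric models.

Readers of record (certsdp reader A 1.2.3 / verify_b 0.5.5; qc-upper-v0 lineages A/B) verify these
predicates OUTSIDE the kernel from the files; a `Certificates/<id>.lean` file states the predicate
instance as an `@[conjecture]` claim node (sha256 of model + certificate in the docstring) and derives
the row by the theorems below (pattern of `Ventures/CertifiedManyBodySolver/Certificates/`).
Nothing in this file asserts any bound.
-/

noncomputable section

namespace Summit.Ventures.CertifiedQuantumChemistry

open Matrix Finset
open Literature.MathematicalPhysics.QuantumLattice Literature.MathematicalPhysics.QuantumChemistry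
open Literature.MathematicalPhysics.QuantumManyBody.StateRelaxation
open scoped ComplexOrder

/-! ## Generic soundness of a spin-resolved sector certificate (any `N̂`, `Ŝ_z`-conserving `H`) -/

section Generic

variable {Λ : Type*} [LinearOrder Λ] [Fintype Λ]

/-- The spin-`σ` particle number `N̂_σ = Σ_x n_{xσ}` acts as `a` (`σ = ↑`) resp. `b` (`σ = ↓`) on the
sector `szSector (a + b) ((a − b)/2)`. -/
theorem spinNumber_mulVec_of_mem_upDownSector (σ : Fin 2) {a b : ℕ} {ψ : Fock (Orb Λ)}
    (hψ : ψ ∈ szSector (a + b) (((a : ℝ) - b) / 2)) :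
    (∑ y : Λ, numberOp y σ) *ᵥ ψ = (((if σ = 0 then (a : ℝ) else (b : ℝ)) : ℝ) : ℂ) • ψ := by
  obtain ⟨hN, hS⟩ := (mem_szSector_iff _ _ ψ).1 hψ
  rw [sum_numberOp_eq_half_totalNumber_add_spinZ, Matrix.add_mulVec, Matrix.smul_mulVec,
    Matrix.smul_mulVec, totalNumber_mulVec_of_isNParticle hN, hS, smul_smul, smul_smul, ← add_smul]
  congr 1
  fin_cases σ
  · simp only [Fin.zero_eta, Fin.isValue, if_true, one_mul]
    push_cast
    ring
  · simp only [Fin.mk_one, Fin.isValue, one_ne_zero, if_false]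
    push_cast
    ring

/-- **Spin-resolved sector certificate ⇒ sector ground energy (generic).** Let `A` be Hermitian on
the Fock space of `Orb Λ`, commuting with `N̂` and `Ŝ_z`, and `a, b ≤ |Λ|`. An identity
`A − c·1 = Σ Λ_IJ O_I† O_J + (Σₖ (A Xₖ − Xₖ A) + Σᵢ (Zᵢ (N̂_↑ − a) + (N̂_↑ − a) Z'ᵢ)
  + Σᵢ (Sᵢ (N̂_↓ − b) + (N̂_↓ − b) S'ᵢ) + Σⱼ bⱼ • wⱼ) + (Σₘ dₘ • (Vₘᴴ − Vₘ) + Σₖ aₖ • vₖ)`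
with `Λ ⪰ 0`, CHARGED ladder words `wⱼ` (`ladderCharge ≠ 0 ∨ ladderSpinCharge ≠ 0`), real `dₘ` and
ladder words `vₖ` proves `c − Σₖ ‖aₖ‖ ≤ sectorGroundEnergy A a b`. Same mechanism as the tree's
`minEnergyOn_szSector_ge_of_sector_certificate` (ideals `N̂ − N`, `Ŝ_z − M`), here with the
spin-resolved ideals `N̂_σ − N_σ` of the cell's certificate format (FORMAT-qcl1 §5). -/
theorem sectorGroundEnergy_ge_of_spin_sector_certificate
    (A : Matrix (Finset (Orb Λ)) (Finset (Orb Λ)) ℂ) (hA : A.IsHermitian)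
    (hAN : Commute A totalNumber) (hAS : Commute A HubbardWave0.spinZ)
    {a b : ℕ} (ha : a ≤ Fintype.card Λ) (hb : b ≤ Fintype.card Λ)
    {m : Type*} [Fintype m] [DecidableEq m] {Λm : Matrix m m ℂ} (hΛm : Λm.PosSemidef)
    (O : m → Matrix (Finset (Orb Λ)) (Finset (Orb Λ)) ℂ)
    {κ : Type*} (s : Finset κ) (Xc : κ → Matrix (Finset (Orb Λ)) (Finset (Orb Λ)) ℂ)
    {ρ : Type*} (r : Finset ρ) (Z Z' : ρ → Matrix (Finset (Orb Λ)) (Finset (Orb Λ)) ℂ)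
    {ρ' : Type*} (r' : Finset ρ') (S S' : ρ' → Matrix (Finset (Orb Λ)) (Finset (Orb Λ)) ℂ)
    {γ : Type*} (u : Finset γ) (bc : γ → ℂ) (cw : γ → List (Orb Λ × Bool))
    (hcw : ∀ j ∈ u, ladderCharge (cw j) ≠ 0 ∨ ladderSpinCharge (cw j) ≠ 0)
    {δ : Type*} (ah : Finset δ) (dc : δ → ℝ) (V : δ → Matrix (Finset (Orb Λ)) (Finset (Orb Λ)) ℂ)
    {κ'' : Type*} (w : Finset κ'') (ac : κ'' → ℂ) (word : κ'' → List (Orb Λ × Bool)) {c : ℝ}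
    (hcert : A - (c : ℂ) • (1 : Matrix (Finset (Orb Λ)) (Finset (Orb Λ)) ℂ) =
      gramForm Λm O +
        (∑ k ∈ s, (A * Xc k - Xc k * A) +
          ∑ i ∈ r, (Z i * (∑ y : Λ, numberOp y 0 - (a : ℂ) • 1) +
            (∑ y : Λ, numberOp y 0 - (a : ℂ) • 1) * Z' i) +
          ∑ i ∈ r', (S i * (∑ y : Λ, numberOp y 1 - (b : ℂ) • 1) +
            (∑ y : Λ, numberOp y 1 - (b : ℂ) • 1) * S' i) +
          ∑ j ∈ u, bc j • ladderWord (cw j)) +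
        (∑ m' ∈ ah, ((dc m' : ℝ) : ℂ) • ((V m')ᴴ - V m') + ∑ k ∈ w, ac k • ladderWord (word k))) :
    c - ∑ k ∈ w, ‖ac k‖ ≤ sectorGroundEnergy A a b := by
  set K : Submodule ℂ (Fock (Orb Λ)) := szSector (a + b) (((a : ℝ) - b) / 2) with hKdef
  have hK : K ≠ ⊥ := szSector_upDown_ne_bot ha hb
  have hKA : ∀ ψ ∈ K, A *ᵥ ψ ∈ K := fun ψ hψ => mulVec_mem_szSector_of_commute hAN hAS hψ
  -- the two spin-resolved number ideals as one `Q = q` family over `ρ ⊕ ρ'`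
  set Q : ρ ⊕ ρ' → Matrix (Finset (Orb Λ)) (Finset (Orb Λ)) ℂ :=
    Sum.elim (fun _ => ∑ y : Λ, numberOp y 0) (fun _ => ∑ y : Λ, numberOp y 1) with hQ
  set q : ρ ⊕ ρ' → ℝ := Sum.elim (fun _ => (a : ℝ)) (fun _ => (b : ℝ)) with hq
  set ZZ : ρ ⊕ ρ' → Matrix (Finset (Orb Λ)) (Finset (Orb Λ)) ℂ := Sum.elim Z S with hZZ
  set ZZ' : ρ ⊕ ρ' → Matrix (Finset (Orb Λ)) (Finset (Orb Λ)) ℂ := Sum.elim Z' S' with hZZ'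
  have hNh : (totalNumber : Matrix (Finset (Orb Λ)) (Finset (Orb Λ)) ℂ)ᴴ = totalNumber := by
    rw [totalNumber_eq_numberDiag_univ]
    exact numberDiag_conjTranspose _
  have hQh : ∀ i ∈ r.disjSum r', (Q i).IsHermitian := by
    rintro (i | i) _
    · exact isHermitian_sum_numberOp 0
    · exact isHermitian_sum_numberOp 1
  have hQq : ∀ i ∈ r.disjSum r', ∀ ψ ∈ K, Q i *ᵥ ψ = ((q i : ℝ) : ℂ) • ψ := by
    rintro (i | i) _ ψ hψ
    · have h := spinNumber_mulVec_of_mem_upDownSector 0 hψ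
      simp only [Fin.isValue, if_true] at h
      exact h
    · have h := spinNumber_mulVec_of_mem_upDownSector 1 hψ
      simp only [Fin.isValue, one_ne_zero, if_false] at h
      exact h
  -- charged words as commutators with `N̂` / `S^z`
  set C : γ → Matrix (Finset (Orb Λ)) (Finset (Orb Λ)) ℂ :=
    fun j => if ladderCharge (cw j) ≠ 0 then totalNumber else HubbardWave0.spinZ with hC
  set W : γ → Matrix (Finset (Orb Λ)) (Finset (Orb Λ)) ℂ :=
    fun j => (bc j / (if ladderCharge (cw j) ≠ 0 then ((ladderCharge (cw j) : ℤ) : ℂ)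
      else ((ladderSpinCharge (cw j) : ℤ) : ℂ) / 2)) • ladderWord (cw j) with hW
  have hC1 : ∀ j ∈ u, C j * A = A * C j := by
    intro j _
    by_cases hq : ladderCharge (cw j) ≠ 0
    · simp only [hC, hq, ne_eq, not_false_eq_true, if_true]; exact hAN.symm.eq
    · simp only [hC, hq, if_false]; exact hAS.symm.eq
  have hCK : ∀ j ∈ u, ∀ ψ ∈ K, C j *ᵥ ψ ∈ K := by
    intro j _ ψ hψ
    obtain ⟨hNψ, hSψ⟩ := (mem_szSector_iff _ _ ψ).1 hψ
    by_cases hq : ladderCharge (cw j) ≠ 0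
    · simp only [hC, hq, ne_eq, not_false_eq_true, if_true]
      rw [totalNumber_mulVec_of_isNParticle hNψ]
      exact Submodule.smul_mem _ _ hψ
    · simp only [hC, hq, if_false]
      rw [hSψ]
      exact Submodule.smul_mem _ _ hψ
  have hCh : ∀ j, (C j)ᴴ = C j := by
    intro j
    by_cases hq : ladderCharge (cw j) ≠ 0
    · simp only [hC, hq, ne_eq, not_false_eq_true, if_true]; exact hNh
    · simp only [hC, hq, if_false]; exact HubbardWave0.spinZ_isHermitian.eq
  have hCK' : ∀ j ∈ u, ∀ ψ ∈ K, (C j)ᴴ *ᵥ ψ ∈ K := fun j hj ψ hψ => by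
    rw [hCh j]; exact hCK j hj ψ hψ
  have hcharged : ∀ j ∈ u, C j * W j - W j * C j = bc j • ladderWord (cw j) := fun j hj =>
    (smul_ladderWord_eq_commutator_of_charged (bc j) (cw j) (hcw j hj)).symm
  -- residual words are contractions
  have hMc : ∀ k ∈ w, (ladderWord (word k)).IsContraction := fun k _ => by
    rw [ladderWord_eq_prod]; exact isContraction_prod_ladder _
  -- the identity in the shape of `Matrix.re_projState_ge_of_local_certificate` (no symmetry family)
  have hmid : ∑ k ∈ s, (A * Xc k - Xc k * A) +
        ∑ l ∈ (∅ : Finset Unit), ((fun _ => (1 : Matrix (Finset (Orb Λ)) (Finset (Orb Λ)) ℂ)) l *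
          (fun _ => (0 : Matrix (Finset (Orb Λ)) (Finset (Orb Λ)) ℂ)) l *
          ((fun _ => (1 : Matrix (Finset (Orb Λ)) (Finset (Orb Λ)) ℂ)) l)ᴴ -
          (fun _ => (0 : Matrix (Finset (Orb Λ)) (Finset (Orb Λ)) ℂ)) l) +
        ∑ i ∈ r.disjSum r', (ZZ i * (Q i - ((q i : ℝ) : ℂ) • 1) + (Q i - ((q i : ℝ) : ℂ) • 1) * ZZ' i) +
        ∑ j ∈ u, (C j * W j - W j * C j) =
      ∑ k ∈ s, (A * Xc k - Xc k * A) +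
        ∑ i ∈ r, (Z i * (∑ y : Λ, numberOp y 0 - (a : ℂ) • 1) +
          (∑ y : Λ, numberOp y 0 - (a : ℂ) • 1) * Z' i) +
        ∑ i ∈ r', (S i * (∑ y : Λ, numberOp y 1 - (b : ℂ) • 1) +
          (∑ y : Λ, numberOp y 1 - (b : ℂ) • 1) * S' i) +
        ∑ j ∈ u, bc j • ladderWord (cw j) := by
    rw [Finset.sum_empty, add_zero, Finset.sum_disjSum, Finset.sum_congr rfl hcharged]
    simp only [hZZ, hZZ', hQ, hq, Sum.elim_inl, Sum.elim_inr, Complex.ofReal_natCast]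
    abel
  have hcert' : A - (c : ℂ) • (1 : Matrix (Finset (Orb Λ)) (Finset (Orb Λ)) ℂ) =
      gramForm Λm O +
        (∑ k ∈ s, (A * Xc k - Xc k * A) +
          ∑ l ∈ (∅ : Finset Unit), ((fun _ => (1 : Matrix (Finset (Orb Λ)) (Finset (Orb Λ)) ℂ)) l *
            (fun _ => (0 : Matrix (Finset (Orb Λ)) (Finset (Orb Λ)) ℂ)) l *
            ((fun _ => (1 : Matrix (Finset (Orb Λ)) (Finset (Orb Λ)) ℂ)) l)ᴴ -
            (fun _ => (0 : Matrix (Finset (Orb Λ)) (Finset (Orb Λ)) ℂ)) l) +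
          ∑ i ∈ r.disjSum r', (ZZ i * (Q i - ((q i : ℝ) : ℂ) • 1) + (Q i - ((q i : ℝ) : ℂ) • 1) * ZZ' i) +
          ∑ j ∈ u, (C j * W j - W j * C j)) +
        (∑ m' ∈ ah, ((dc m' : ℝ) : ℂ) • ((V m')ᴴ - V m') + ∑ k ∈ w, ac k • ladderWord (word k)) := by
    rw [hmid]; exact hcert
  have h := Matrix.re_projState_ge_of_local_certificate hA K hKA hK A hΛm O s Xc (∅ : Finset Unit)
    (fun _ => 1) (fun _ => 0) (fun _ h => absurd h (Finset.notMem_empty _))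
    (fun _ h => absurd h (Finset.notMem_empty _)) (fun _ h => absurd h (Finset.notMem_empty _))
    (fun _ h => absurd h (Finset.notMem_empty _))
    (r.disjSum r') Q ZZ ZZ' q hQh hQq u C W hC1 hCK hCK' ah dc V w ac
    (fun k => ladderWord (word k)) hMc hcert'
  -- `ω_P(A) = minEnergyOn A K = sectorGroundEnergy A a b`
  rw [projState_self (sectorGroundProj_isHermitian A K) (sectorGroundProj_mul_self A K)
    (sectorGroundProj_ne_zero hA K hKA hK) (sectorGroundProj_mul hA K), Complex.ofReal_re] at h
  exact h

end Generic

/-! ## The cell's certificate predicates on a model `F : Model k` -/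

variable {k : ℕ}

/-- Abbreviation: operators on the Fock space of the `2k` spin orbitals of a `k`-orbital model. -/
abbrev Op (k : ℕ) : Type := Matrix (Finset (Orb (Fin k))) (Finset (Orb (Fin k))) ℂ

/-- **LOWER certificate predicate** (FORMAT-qcl1, any condition string D…DQGT1T2′, profile `sz`):
there EXIST a constant `c` with `lo ≤ c − Σ‖a_k‖`, a PSD Gram matrix `Λ` over a finite family of
operators `O_I` (all PSD blocks stacked), commutator multipliers `X_k`, two-sided multipliers of the
sector ideals `(N̂_↑ − a)`, `(N̂_↓ − b)`, dropped CHARGED ladder words, anti-Hermitian rounding parts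
with real coefficients, and residual ladder words `v_k` with coefficients `a_k`, such that the
operator identity below holds on the Fock space. All families are `Fin n`-indexed (possibly empty).
This is what readers A/B of record establish from the files (the generator's operator → variable map
being fixed by FORMAT-qcl1 and cross-validated A∥B). -/
def LowerCertificate (F : Model k) (a b : ℕ) (lo : ℚ) : Prop :=
  ∃ (n nX nZ nS nC nV nR : ℕ) (Λm : Matrix (Fin n) (Fin n) ℂ) (_ : Λm.PosSemidef) (O : Fin n → Op k)
    (X : Fin nX → Op k) (Z Z' : Fin nZ → Op k) (S S' : Fin nS → Op k)
    (bc : Fin nC → ℂ) (cw : Fin nC → List (Orb (Fin k) × Bool))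
    (_ : ∀ j, ladderCharge (cw j) ≠ 0 ∨ ladderSpinCharge (cw j) ≠ 0)
    (dc : Fin nV → ℝ) (V : Fin nV → Op k) (ac : Fin nR → ℂ) (v : Fin nR → List (Orb (Fin k) × Bool))
    (c : ℝ),
    ((lo : ℚ) : ℝ) ≤ c - ∑ j, ‖ac j‖ ∧
    F.hamiltonian - (c : ℂ) • (1 : Op k) =
      gramForm Λm O +
        (∑ i, (F.hamiltonian * X i - X i * F.hamiltonian) +
          ∑ i, (Z i * (∑ y : Fin k, numberOp y 0 - (a : ℂ) • 1) +
            (∑ y : Fin k, numberOp y 0 - (a : ℂ) • 1) * Z' i) +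
          ∑ i, (S i * (∑ y : Fin k, numberOp y 1 - (b : ℂ) • 1) +
            (∑ y : Fin k, numberOp y 1 - (b : ℂ) • 1) * S' i) +
          ∑ j, bc j • ladderWord (cw j)) +
        (∑ i, ((dc i : ℝ) : ℂ) • ((V i)ᴴ - V i) + ∑ j, ac j • ladderWord (v j))

/-- **SOUNDNESS OF LOWER ROWS (T-04 L).** A lower certificate for a symmetric model in a sector with
`a, b ≤ k` proves the lower row: `LowerCertificate F a b lo → LowerRow F a b lo`. -/
theorem lowerRow_of_certificate {F : Model k} (hF : F.IsSymmetric) {a b : ℕ} (ha : a ≤ k) (hb : b ≤ k)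
    {lo : ℚ} (h : LowerCertificate F a b lo) : LowerRow F a b lo := by
  obtain ⟨n, nX, nZ, nS, nC, nV, nR, Λm, hΛm, O, X, Z, Z', S, S', bc, cw, hcw, dc, V, ac, v, c, hlo,
    hcert⟩ := h
  have hbound := sectorGroundEnergy_ge_of_spin_sector_certificate F.hamiltonian
    (Model.hamiltonian_isHermitian hF) (molecularHamiltonian_commute_totalNumber _ _ _)
    (molecularHamiltonian_commute_spinZ _ _ _) (by simpa using ha) (by simpa using hb) hΛm O
    Finset.univ X Finset.univ Z Z' Finset.univ S S' Finset.univ bc cw (fun j _ => hcw j)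
    Finset.univ dc V Finset.univ ac v hcert
  exact ⟨ha, hb, le_trans hlo hbound⟩

/-- **UPPER certificate predicate** (FORMAT-qcu0 §0): an explicit NONZERO vector supported on the
`(a, b)` determinant sector whose exact Rayleigh data satisfy `Re ⟨ψ, H_F ψ⟩ ≤ hi · ⟨ψ, ψ⟩`
(integer CI vector: both sides exact rationals; MPS: `hi` a dyadic above the interval quotient). -/
def UpperCertificate (F : Model k) (a b : ℕ) (hi : ℚ) : Prop :=
  ∃ ψ : Fock (Orb (Fin k)), IsInSector a b ψ ∧ ψ ≠ 0 ∧
    (star ψ ⬝ᵥ F.hamiltonian *ᵥ ψ).re ≤ ((hi : ℚ) : ℝ) * (star ψ ⬝ᵥ ψ).re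

/-- A NONZERO vector supported on the `(a, b)` sector forces the physical range `a ≤ k ∧ b ≤ k`
(some occupation `s` with `ψ s ≠ 0` has `a` up and `b` down electrons among `k` orbitals). -/
theorem range_of_isInSector_ne_zero {a b : ℕ} {ψ : Fock (Orb (Fin k))} (hψ : IsInSector a b ψ)
    (h0 : ψ ≠ 0) : a ≤ k ∧ b ≤ k := by
  by_contra hne
  apply h0
  funext s
  refine hψ s fun hs => hne ?_
  obtain ⟨ha, hb⟩ := hs
  exact ⟨ha ▸ (Finset.card_le_univ _).trans_eq (Fintype.card_fin k),
    hb ▸ (Finset.card_le_univ _).trans_eq (Fintype.card_fin k)⟩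

/-- **SOUNDNESS OF UPPER ROWS (T-04 U).** Rayleigh–Ritz in the sector:
`UpperCertificate F a b hi → UpperRow F a b hi` for a symmetric model (the witness supplies the range). -/
theorem upperRow_of_certificate {F : Model k} (hF : F.IsSymmetric) {a b : ℕ} {hi : ℚ}
    (h : UpperCertificate F a b hi) : UpperRow F a b hi := by
  obtain ⟨ψ, hψ, h0, hu⟩ := h
  obtain ⟨ha, hb⟩ := range_of_isInSector_ne_zero hψ h0
  exact ⟨ha, hb, sectorGroundEnergy_le_of_rayleigh (Model.hamiltonian_isHermitian hF) hψ h0 hu⟩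

/-- **COMPLETENESS of the upper predicate.** Every true upper row of a symmetric model HAS an
upper certificate (the sector ground state itself; the row carries the range): the claim nodes of
`Certificates/` are therefore exactly as strong as the rows they carry. -/
theorem upperCertificate_of_upperRow {F : Model k} (hF : F.IsSymmetric) {a b : ℕ} {hi : ℚ}
    (h : UpperRow F a b hi) : UpperCertificate F a b hi := by
  obtain ⟨ha, hb, h⟩ := h
  obtain ⟨ψ, hψ, hψ1, hHψ⟩ := exists_unit_eigen_sectorGroundEnergy
    (Model.hamiltonian_isHermitian hF) (by simpa using ha) (by simpa using hb)
  refine ⟨ψ, hψ, ?_, ?_⟩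
  · rintro rfl
    simp at hψ1
  · change F.hamiltonian *ᵥ ψ = ((sectorGroundEnergy F.hamiltonian a b : ℝ) : ℂ) • ψ at hHψ
    rw [hHψ, dotProduct_smul, hψ1, smul_eq_mul, mul_one, Complex.ofReal_re, Complex.one_re, mul_one]
    exact h

/-- `UpperCertificate ↔ UpperRow` for symmetric models. -/
theorem upperCertificate_iff_upperRow {F : Model k} (hF : F.IsSymmetric) (a b : ℕ) (hi : ℚ) :
    UpperCertificate F a b hi ↔ UpperRow F a b hi :=
  ⟨upperRow_of_certificate hF, upperCertificate_of_upperRow hF⟩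

/-- A two-sided CERTIFIED row from one certificate of each kind. -/
theorem bracket_of_certificates {F : Model k} (hF : F.IsSymmetric) {a b : ℕ} (ha : a ≤ k) (hb : b ≤ k)
    {lo hi : ℚ} (hL : LowerCertificate F a b lo) (hU : UpperCertificate F a b hi) :
    Bracket F a b lo hi :=
  ⟨lowerRow_of_certificate hF ha hb hL, upperRow_of_certificate hF hU⟩

end Summit.Ventures.CertifiedQuantumChemistry

end
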